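import Summits.SmoothPoincare4.SmoothPoincare4.Theses.ConvexBisection
import Summits.SmoothPoincare4.SmoothPoincare4.Theorems.ConvexBisectionAcyclicBisectionRigidityFoldCertificates
import Summits.SmoothPoincare4.SmoothPoincare4.Theorems.ConvexBisectionAcyclicBisectionRigidityStubUnfoldedSphere
import Literature.Topology.FourManifolds.LefschetzHandlebody
import Literature.Topology.FourManifolds.LefschetzModelFacts
import Literature.Topology.FourManifolds.CerfGammaFour
import HarnessLib

/-!
# Summit-equivalence certificates for crux `ConvexBisection.AcyclicBisectionRigidity`
# (item stmt-SmoothPoincare4-10507; line lead c9, 2026-08-17)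

Sorry-free, pure logic.  The kernel-checked record behind the line verdict of the 13th lead seat:

* `crux_iff_smoothPoincare4_of_exists` — **given the route's own sibling crux
  `AcyclicBisectionExists` (stmt-SmoothPoincare4-10508: every homotopy 4-sphere admits an acyclic
  common-contact Stein bisection; Etnyre–Fuller 2006 Thm. 1 + Baykur 2006 Lemma 1 / Thm. 5.1, whose
  formalisation is the live work of item 10508), the crux `AcyclicBisectionRigidity` is EQUIVALENT to
  the summit `SmoothPoincare4`.**  (`⇒` is the route's deciding theorem `closes`; `⇐` is shielding.)
  So no line can close 10507 short of proving the smooth 4-dimensional Poincaré conjecture, and a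
  refutation of 10507 is an exotic `S⁴`.
* `foldRecognition_iff_smoothPoincare4_of_facts` — the Transfer `C⁺` of line
  `folded-curve-branch-locus` ("homotopy 4-spheres with a sorted balanced bi-spanning fibred
  Lefschetz model are `S⁴`", all genera) is equivalent to `SmoothPoincare4` modulo the four named
  facts NF1–NF4 of `Literature/Topology/FourManifolds/LefschetzModelFacts.lean` (lead a4's
  `helper_spc4_of_foldRecognition_of_facts`, p135540, plus shielding).
* `smoothPoincare4_of_higherGenusFold_of_facts` / `higherGenusFold_of_smoothPoincare4` — the line's
  apex stub `stub_higherGenusFold` (fold genus `≥ 2`, registered signature verbatim) is equivalent to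
  `SmoothPoincare4` modulo NF1–NF4, Cerf's `Γ₄ = 0` (`cerf_twistedSphere_four`, consumed by the LANDED
  genus-`0` rung `…StubUnfoldedSphere.lean`, p134910) and the genus-`1` rung (registered signature of
  `stub_genusOneFold`, Matsumoto 1985 Thm. 3.2, taken as a hypothesis).

Nothing here is progress on the crux; it is the certificate that the crux, as filed, is the summit in
costume once its sibling existence crux is granted.
-/

noncomputable section

open scoped Manifold ContDiff Topology ContinuousMap
open Set Function
open CategoryTheory.Limits
open Literature.Topology.FourManifolds Literature.Topology.FourManifolds.LefschetzBase

-- the prescribed namespace `Summit.<P>.<Sub>.…` duplicates `SmoothPoincare4` (P = Sub)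
set_option linter.dupNamespace false

namespace Summit.SmoothPoincare4.SmoothPoincare4.Theorems.AcyclicBisectionRigidity.SummitEquivalence

open Summit.SmoothPoincare4.SmoothPoincare4.Theses.ConvexBisection
open Summit.SmoothPoincare4.SmoothPoincare4.Theorems.AcyclicBisectionRigidity.FoldedCurveBranchLocus

/-! ## The crux is the summit, given the sibling existence crux -/

/-- **Shielding at the crux: `SmoothPoincare4 → AcyclicBisectionRigidity`** (the bisection hypothesis
is simply dropped). [folklore] -/
theorem crux_of_smoothPoincare4 (h : SmoothPoincare4) : AcyclicBisectionRigidity :=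
  fun M _ _ _ _ _ e _ => h M inferInstance inferInstance e

/-- **The route's deciding step: `AcyclicBisectionExists → AcyclicBisectionRigidity → SmoothPoincare4`**
(feed the existence crux's bisection of `M ≃ₕ S⁴` to the rigidity crux). [folklore] -/
theorem smoothPoincare4_of_crux_of_exists (hE : AcyclicBisectionExists)
    (hR : AcyclicBisectionRigidity) : SmoothPoincare4 :=
  fun M _ _ _ _ _ e => hR M e (hE M e)

/-- **CERTIFICATE: given `AcyclicBisectionExists` (stmt-SmoothPoincare4-10508 — Etnyre–Fuller 2006
Thm. 1 with Baykur 2006 Lemma 1 and Thm. 5.1), the crux `AcyclicBisectionRigidity`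
(stmt-SmoothPoincare4-10507) is equivalent to `SmoothPoincare4`.**  The acyclic-bisection hypothesis
restricts no homotopy 4-sphere, so the crux carries the whole summit. [folklore] -/
theorem crux_iff_smoothPoincare4_of_exists (hE : AcyclicBisectionExists) :
    AcyclicBisectionRigidity ↔ SmoothPoincare4 :=
  ⟨smoothPoincare4_of_crux_of_exists hE, crux_of_smoothPoincare4⟩

/-! ## The fold transfer of line `folded-curve-branch-locus` is the summit, modulo NF1–NF4 -/

/-- **Fold recognition in every genus `↔ SmoothPoincare4`, modulo the four Lefschetz facts** NF1
`modelsOnFibred_exists`, NF2 `modelsOn_counts_of_homotopyEquiv_sphere`, NF3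
`modelsOnFibred_balance_of_homotopyEquiv_sphere`, NF4 `modelsOnFibred_of_reach`.  `⇒` is lead a4's
`helper_spc4_of_foldRecognition_of_facts` (every homotopy 4-sphere HAS a sorted allowable balanced
bi-spanning fibred model, so recognising all of them is the summit); `⇐` is shielding.
[cite: EtnyreFuller2006, Thm. 1, Prop. 12, eq. (d3)] [cite: Baykur2006, Lemma 1 and §5] -/
theorem foldRecognition_iff_smoothPoincare4_of_facts
    (h₁ : modelsOnFibred_exists) (h₂ : modelsOn_counts_of_homotopyEquiv_sphere)
    (h₃ : modelsOnFibred_balance_of_homotopyEquiv_sphere) (h₄ : modelsOnFibred_of_reach) :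
    (∀ (g : ℕ) (M : Type) [TopologicalSpace M] [T2Space M] [SecondCountableTopology M]
      [ChartedSpace (EuclideanSpace ℝ (Fin 4)) M] [IsManifold (𝓡 4) ∞ M],
      M ≃ₕ Metric.sphere (0 : EuclideanSpace ℝ (Fin 5)) 1 →
      ∀ (P N : List ((Fin g ⊕ Fin g → ℤ) × Bool)),
        (∀ x ∈ P, x.2 = true) → (∀ x ∈ N, x.2 = false) → (∀ x ∈ P ++ N, x.1 ≠ 0) →
        P.length = 2 * g → N.length = 2 * g →
        Submodule.span ℚ (Set.range fun i : Fin P.length =>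
          fun j : Fin g ⊕ Fin g => ((P.get i).1 j : ℚ)) = ⊤ →
        Submodule.span ℚ (Set.range fun i : Fin N.length =>
          fun j : Fin g ⊕ Fin g => ((N.get i).1 j : ℚ)) = ⊤ →
        ModelsOnFibred M g (P ++ N) →
        Nonempty (M ≃ₘ⟮𝓡 4, 𝓡 4⟯ Metric.sphere (0 : EuclideanSpace ℝ (Fin 5)) 1)) ↔
    SmoothPoincare4 :=
  ⟨helper_spc4_of_foldRecognition_of_facts h₁ h₂ h₃ h₄,
    fun h _ M _ _ _ _ _ e _ _ _ _ _ _ _ _ _ _ => h M inferInstance inferInstance e⟩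

/-! ## The apex stub of the line is the summit, modulo NF1–NF4, Cerf and the genus-one rung -/

/-- **`stub_higherGenusFold` (fold genus `≥ 2`, registered signature verbatim) implies
`SmoothPoincare4`, modulo NF1–NF4, Cerf's `Γ₄ = 0` and the genus-`1` rung** (registered signature of
`stub_genusOneFold` verbatim; Matsumoto 1985 Thm. 3.2 on paper).  Genus `0` is discharged by the LANDED
rung `stub_unfoldedSphere` (p134910): a balanced genus-`0` fold has the empty word, so `M` is a twisted
sphere, standard by Cerf.  This is the kernel-checked form, in `Theorems/`, of lead a4's skeleton
certificate `spc4_of_higherGenusFold_of_facts`: the apex is SUMMIT-sized.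
[cite: Matsumoto1985, Thm. 3.2] [cite: Cerf1968, main theorem (Γ₄ = 0)] -/
theorem smoothPoincare4_of_higherGenusFold_of_facts
    (h₁ : modelsOnFibred_exists) (h₂ : modelsOn_counts_of_homotopyEquiv_sphere)
    (h₃ : modelsOnFibred_balance_of_homotopyEquiv_sphere) (h₄ : modelsOnFibred_of_reach)
    (hCerf : cerf_twistedSphere_four)
    (hD : ∀ (M : Type) [TopologicalSpace M] [T2Space M] [SecondCountableTopology M]
      [ChartedSpace (EuclideanSpace ℝ (Fin 4)) M] [IsManifold (𝓡 4) ∞ M],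
      M ≃ₕ Metric.sphere (0 : EuclideanSpace ℝ (Fin 5)) 1 →
      ∀ (P N : List ((Fin 1 ⊕ Fin 1 → ℤ) × Bool)),
        (∀ x ∈ P, x.2 = true) → (∀ x ∈ N, x.2 = false) → (∀ x ∈ P ++ N, x.1 ≠ 0) →
        P.length = 2 * 1 → N.length = 2 * 1 →
        Submodule.span ℚ (Set.range fun i : Fin P.length =>
          fun j : Fin 1 ⊕ Fin 1 => ((P.get i).1 j : ℚ)) = ⊤ →
        Submodule.span ℚ (Set.range fun i : Fin N.length =>
          fun j : Fin 1 ⊕ Fin 1 => ((N.get i).1 j : ℚ)) = ⊤ →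
        ModelsOnFibred M 1 (P ++ N) →
        Nonempty (M ≃ₘ⟮𝓡 4, 𝓡 4⟯ Metric.sphere (0 : EuclideanSpace ℝ (Fin 5)) 1))
    (hB : ∀ (M : Type) [TopologicalSpace M] [T2Space M] [SecondCountableTopology M]
      [ChartedSpace (EuclideanSpace ℝ (Fin 4)) M] [IsManifold (𝓡 4) ∞ M],
      M ≃ₕ Metric.sphere (0 : EuclideanSpace ℝ (Fin 5)) 1 →
      ∀ (g : ℕ), 2 ≤ g → ∀ (P N : List ((Fin g ⊕ Fin g → ℤ) × Bool)),
        (∀ x ∈ P, x.2 = true) → (∀ x ∈ N, x.2 = false) → (∀ x ∈ P ++ N, x.1 ≠ 0) →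
        P.length = 2 * g → N.length = 2 * g →
        Submodule.span ℚ (Set.range fun i : Fin P.length =>
          fun j : Fin g ⊕ Fin g => ((P.get i).1 j : ℚ)) = ⊤ →
        Submodule.span ℚ (Set.range fun i : Fin N.length =>
          fun j : Fin g ⊕ Fin g => ((N.get i).1 j : ℚ)) = ⊤ →
        ModelsOnFibred M g (P ++ N) →
        Nonempty (M ≃ₘ⟮𝓡 4, 𝓡 4⟯ Metric.sphere (0 : EuclideanSpace ℝ (Fin 5)) 1)) :
    SmoothPoincare4 := by
  refine helper_spc4_of_foldRecognition_of_facts h₁ h₂ h₃ h₄ ?_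
  intro g M _ _ _ _ _ e P N hP hN hnz hlP hlN hsP hsN hmodel
  rcases Nat.lt_or_ge g 2 with hlt | hge
  · interval_cases g
    · -- genus 0: the balanced word is empty; twisted sphere; Cerf (landed rung)
      have hP0 : P = [] := List.eq_nil_of_length_eq_zero (by simpa using hlP)
      have hN0 : N = [] := List.eq_nil_of_length_eq_zero (by simpa using hlN)
      subst hP0
      subst hN0
      exact stub_unfoldedSphere hCerf M (by simpa using hmodel)
    · -- genus 1: the Matsumoto rung, as hypothesised
      exact hD M e P N hP hN hnz hlP hlN hsP hsN hmodel
  · -- genus ≥ 2: the apex stub, as hypothesised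
    exact hB M e g hge P N hP hN hnz hlP hlN hsP hsN hmodel

/-- **Conversely the apex stub is implied by the summit** (shielded shape `∀ M ≃ₕ S⁴, P M → M ≅ S⁴`);
with `smoothPoincare4_of_higherGenusFold_of_facts` the apex of the line is EQUIVALENT to
`SmoothPoincare4` modulo NF1–NF4, Cerf and the genus-`1` rung. [folklore] -/
theorem higherGenusFold_of_smoothPoincare4 (h : SmoothPoincare4) :
    ∀ (M : Type) [TopologicalSpace M] [T2Space M] [SecondCountableTopology M]
      [ChartedSpace (EuclideanSpace ℝ (Fin 4)) M] [IsManifold (𝓡 4) ∞ M],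
      M ≃ₕ Metric.sphere (0 : EuclideanSpace ℝ (Fin 5)) 1 →
      ∀ (g : ℕ), 2 ≤ g → ∀ (P N : List ((Fin g ⊕ Fin g → ℤ) × Bool)),
        (∀ x ∈ P, x.2 = true) → (∀ x ∈ N, x.2 = false) → (∀ x ∈ P ++ N, x.1 ≠ 0) →
        P.length = 2 * g → N.length = 2 * g →
        Submodule.span ℚ (Set.range fun i : Fin P.length =>
          fun j : Fin g ⊕ Fin g => ((P.get i).1 j : ℚ)) = ⊤ →
        Submodule.span ℚ (Set.range fun i : Fin N.length =>
          fun j : Fin g ⊕ Fin g => ((N.get i).1 j : ℚ)) = ⊤ →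
        ModelsOnFibred M g (P ++ N) →
        Nonempty (M ≃ₘ⟮𝓡 4, 𝓡 4⟯ Metric.sphere (0 : EuclideanSpace ℝ (Fin 5)) 1) :=
  fun M _ _ _ _ _ e _ _ _ _ _ _ _ _ _ _ _ _ => h M inferInstance inferInstance e

end Summit.SmoothPoincare4.SmoothPoincare4.Theorems.AcyclicBisectionRigidity.SummitEquivalence

end
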